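/-
Copyright (c) 2026. All rights reserved.
Released under Apache 2.0 license as described in the file LICENSE.
-/
import Summits.Schanuel.Schanuel.Theorems.ZilberEacRealFibreDensity
import Summits.Schanuel.Schanuel.Theorems.ZilberEacDensityRealSlope
import HarnessLib

/-!
# Real-slope line × arbitrary plane curve IV: the case certificate, the strip, infinitude

HONEST FRAMING.  Fourth (closing) file of the series `ZilberEacRealFibre{Dominance,Zeros,Density}`
(cell `pub-schanuel`, seat 1) on the split surfaces

  `W(a, b; P) = {x₁ = a x₀ + b} × Z(P) ⊆ ℂ² × ℂ²`, `a ∈ ℝ`, `b ∈ ℂ`, `P ∈ ℂ[y₀, y₁]`.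

The density theorem `unprojectedDense_lineCurveSurface_of_mmCase` of file III answers
Mantova–Masser's "unprojected density" question (D. Masser, V. Mantova, *Polynomial-exponential
equations — some new cases of solvability*, PLMS 129 (2024) = arXiv:2303.05592, §1 p. 5; OPEN in
general) on this family UNDER the hypothesis `MMCaseDimPiOneFree W` (their case (dim-π-S-1-free)).
Here we certify that the hypothesis is the expected one, so that the instance is not vacuous:

* `projAdd_image_lineCurveSurface_inter_torusLocus`: `π(W ∩ G²)` is the whole base line (given one
  torus zero of `P`), hence `addProjDim W = 1` (`addProjDim_lineCurveSurface`) and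
  "`cl π(W ∩ G²)` is a line of rational slope" `↔ a ∈ ℚ`
  (`not_isRationalSlopeLine_lineCurveSurface_iff`);
* `mmCase_lineCurveSurface_iff`: for IRREDUCIBLE `P`,
  `MMCaseDimPiOneFree W(a, b; P) ↔ (a ∉ ℚ ∧ Z(P) ∩ (ℂˣ)² ≠ ∅)`;
* `unprojectedDensityQuestion_instance_lineCurveSurface`: consequently on the whole family
  (`a ∈ ℝ ∖ ℚ`, `P` irreducible with a torus zero) BOTH the case hypotheses AND the density hold,
  and `mmCase_lineCurveSurface_iff_dense`: for `a ∈ ℝ`, irreducible `P`, the case hypotheses hold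
  iff (`a ∉ ℚ`, a torus zero exists, and) the exponential points are Zariski dense.

Two elementary corollaries of files I–II for the exponential points themselves
(`a ∈ ℝ ∖ ℚ`): all solutions of `P(e^z, e^{az+b}) = 0` lie in a vertical strip `|Re z| ≤ K(a, b, P)`
(`exists_strip_of_eval_exp_eq_zero`, from monomial domination), and there are infinitely many of
them as soon as `Z(P)` meets the torus (`setOf_eval_exp_eq_zero_infinite`).

All of this is a modest rung in the case ladder of Zilber's Exponential-Algebraic Closedness
conjecture.  It is NOT Schanuel's conjecture (neither used nor implied; EAC ⇏ SC); the open cell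
`EC(3,2)` of the ladder stays OPEN, and so does the density question for non-real slopes with
non-graph fibres and for non-split surfaces.
-/

noncomputable section

open Filter Topology Set Complex MvPolynomial
open Literature.NumberTheory.Transcendental Literature.ModelTheory.Zilber
open Literature.ModelTheory.ExponentialFields

set_option linter.dupNamespace false

namespace Summit.Schanuel.Schanuel.Theorems

/-! ## Part A. The additive projection of `W ∩ G²` and the case certificate -/

section Case

variable (a : ℝ) (b : ℂ) {P : MvPolynomial (Fin 2) ℂ}

/-- `π(W(a, b; P) ∩ G²)` is the base line `{x₁ = a x₀ + b}` as soon as `Z(P)` has a torus point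
(pair every base point with that torus point). (new) -/
theorem projAdd_image_lineCurveSurface_inter_torusLocus
    (hW : (lineCurveSurface a b P ∩ torusLocus ℂ 2).Nonempty) :
    projAdd '' (lineCurveSurface a b P ∩ torusLocus ℂ 2) =
      graphBase (Polynomial.aeval (X 0 : MvPolynomial (Fin 1) ℂ) (linePoly (a : ℂ) b)) := by
  obtain ⟨c, h0, h1, hc⟩ := (lineCurveSurface_inter_torusLocus_nonempty_iff a b P).1 hW
  ext x
  simp only [Set.mem_image, Set.mem_inter_iff, graphBase, Set.mem_setOf_eq,
    eval_polynomial_aeval_X, eval_linePoly]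
  constructor
  · rintro ⟨w, ⟨hw, -⟩, rfl⟩
    simpa [lineCurveSurface] using hw.1
  · intro hx
    refine ⟨Sum.elim x c, ⟨⟨?_, by simpa using hc⟩, fun i => ?_⟩, ?_⟩
    · have h' : x 1 = (a : ℂ) * x 0 + b := by simpa using hx
      simpa using h'
    · fin_cases i
      · simpa using h0
      · simpa using h1
    · funext i
      simp

/-- The additive projection of `W ∩ G²` coincides with that of the graph line surface
`{x₁ = a x₀ + b, y₀ = y₁}` of `EACDensityFamilies`, so all base invariants transfer. (new) -/
theorem projAdd_image_lineCurveSurface_eq_graphPolySurface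
    (hW : (lineCurveSurface a b P ∩ torusLocus ℂ 2).Nonempty) :
    projAdd '' (lineCurveSurface a b P ∩ torusLocus ℂ 2) =
      projAdd '' (graphPolySurface (linePoly (a : ℂ) b) Polynomial.X ∩ torusLocus ℂ 2) := by
  rw [projAdd_image_lineCurveSurface_inter_torusLocus a b hW,
    projAdd_image_graphPolySurface_inter_torusLocus _ Polynomial.X_ne_zero]

/-- **`dim cl π(W ∩ G²) = 1`** (given a torus zero of `P`). (new) -/
theorem addProjDim_lineCurveSurface (hW : (lineCurveSurface a b P ∩ torusLocus ℂ 2).Nonempty) :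
    addProjDim ℂ 2 (lineCurveSurface a b P) = (1 : ℕ) := by
  unfold addProjDim
  rw [projAdd_image_lineCurveSurface_eq_graphPolySurface a b hW]
  exact addProjDim_graphPolySurface _ Polynomial.X_ne_zero

/-- **The closure of the base is a line of rational slope iff `a ∈ ℚ`** (given a torus zero of
`P`). (new) -/
theorem not_isRationalSlopeLine_lineCurveSurface_iff
    (hW : (lineCurveSurface a b P ∩ torusLocus ℂ 2).Nonempty) :
    ¬ IsRationalSlopeLine (zeroLocus ℂ (vanishingIdeal ℂ
        (projAdd '' (lineCurveSurface a b P ∩ torusLocus ℂ 2)))) ↔ Irrational a := by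
  rw [projAdd_image_lineCurveSurface_eq_graphPolySurface a b hW, ← forall_rat_ne_coe_iff]
  constructor
  · intro h
    have hmm : MMCaseDimPiOneFree (graphPolySurface (linePoly (a : ℂ) b) Polynomial.X) :=
      ⟨isIrreducibleClosed_graphPolySurface _ _,
        graphPolySurface_inter_torusLocus_nonempty _ Polynomial.X_ne_zero,
        zariskiDim_graphPolySurface _ _, addProjDim_graphPolySurface _ Polynomial.X_ne_zero, h⟩
    exact (mmCase_graphPolySurface_line_iff (a : ℂ) b Polynomial.X_ne_zero).1 hmm
  · intro ha
    exact not_isRationalSlopeLine_graphPolySurface _ Polynomial.X_ne_zero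
      (lineCoeffs_eq_zero_of_not_rat ha)

/-- **Case certificate.** For irreducible `P ∈ ℂ[y₀, y₁]` and real `a`, the surface
`W(a, b; P)` satisfies the hypotheses of Mantova–Masser's case (dim-π-S-1-free) iff `a ∉ ℚ` and
`Z(P)` meets the torus `(ℂˣ)²`. (new) -/
theorem mmCase_lineCurveSurface_iff (hirr : Irreducible P) :
    MMCaseDimPiOneFree (lineCurveSurface a b P) ↔
      Irrational a ∧ (lineCurveSurface a b P ∩ torusLocus ℂ 2).Nonempty := by
  constructor
  · rintro ⟨-, hW, -, -, hline⟩
    exact ⟨(not_isRationalSlopeLine_lineCurveSurface_iff a b hW).1 hline, hW⟩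
  · rintro ⟨ha, hW⟩
    exact ⟨isIrreducibleClosed_lineCurveSurface a b hirr, hW, zariskiDim_lineCurveSurface a b hirr,
      addProjDim_lineCurveSurface a b hW, (not_isRationalSlopeLine_lineCurveSurface_iff a b hW).2 ha⟩

/-- Rational slopes are never in the case (whatever `P`). (new) -/
theorem not_mmCase_lineCurveSurface_rat (r : ℚ) (b : ℂ) (P : MvPolynomial (Fin 2) ℂ) :
    ¬ MMCaseDimPiOneFree (lineCurveSurface (r : ℝ) b P) := by
  rintro ⟨-, hW, -, -, hline⟩
  exact (not_isRationalSlopeLine_lineCurveSurface_iff (r : ℝ) b hW).1 hline ⟨r, rfl⟩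

/-- **Mantova–Masser's question, instance class** `{x₁ = a x₀ + b} × Z(P)` (`a ∈ ℝ ∖ ℚ`,
`b ∈ ℂ`, `P` irreducible with a zero in `(ℂˣ)²`): the case hypotheses hold AND the exponential
points are Zariski dense.  A decided instance class of an OPEN question; a modest rung of EAC,
NOT Schanuel's conjecture. (new) -/
theorem unprojectedDensityQuestion_instance_lineCurveSurface {a : ℝ} (ha : Irrational a) (b : ℂ)
    (hirr : Irreducible P) (hW : (lineCurveSurface a b P ∩ torusLocus ℂ 2).Nonempty) :
    MMCaseDimPiOneFree (lineCurveSurface a b P) ∧ UnprojectedDense (lineCurveSurface a b P) :=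
  ⟨(mmCase_lineCurveSurface_iff a b hirr).2 ⟨ha, hW⟩, unprojectedDense_lineCurveSurface ha b hirr hW⟩

/-- The same with the torus point given as an explicit zero `c ∈ (ℂˣ)²` of `P`. (new) -/
theorem unprojectedDensityQuestion_instance_lineCurveSurface_of_zero {a : ℝ} (ha : Irrational a)
    (b : ℂ) (hirr : Irreducible P) {c : Fin 2 → ℂ} (h0 : c 0 ≠ 0) (h1 : c 1 ≠ 0)
    (hc : MvPolynomial.eval c P = 0) :
    MMCaseDimPiOneFree (lineCurveSurface a b P) ∧ UnprojectedDense (lineCurveSurface a b P) :=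
  unprojectedDensityQuestion_instance_lineCurveSurface ha b hirr
    ((lineCurveSurface_inter_torusLocus_nonempty_iff a b P).2 ⟨c, h0, h1, hc⟩)

/-- **On the family `{W(a, b; P)}` (`a ∈ ℝ`, `P` irreducible) the case hypotheses are equivalent
to: `a ∉ ℚ`, a torus point exists, and the exponential points are Zariski dense.** (new) -/
theorem mmCase_lineCurveSurface_iff_dense (hirr : Irreducible P) :
    MMCaseDimPiOneFree (lineCurveSurface a b P) ↔
      Irrational a ∧ (lineCurveSurface a b P ∩ torusLocus ℂ 2).Nonempty ∧
        UnprojectedDense (lineCurveSurface a b P) := by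
  rw [mmCase_lineCurveSurface_iff a b hirr]
  exact ⟨fun h => ⟨h.1, h.2, unprojectedDense_lineCurveSurface h.1 b hirr h.2⟩,
    fun h => ⟨h.1, h.2.1⟩⟩

end Case

/-! ## Part B. Where the exponential points are: a vertical strip, and infinitely many -/

section Points

variable {a : ℝ} {b : ℂ} {P : MvPolynomial (Fin 2) ℂ}

/-- **Vertical strip.** For `a ∈ ℝ ∖ ℚ` and `P ≠ 0` there is `K` with `|Re z| ≤ K` for every
solution of `P(e^z, e^{az+b}) = 0`: on the exponential points `ψ = log|y₁| - a log|y₀| - Re b`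
vanishes identically, and monomial domination bounds `log|y₀| = Re z` there. (new) -/
theorem exists_strip_of_eval_exp_eq_zero (ha : Irrational a) (b : ℂ) (hP : P ≠ 0) :
    ∃ K : ℝ, ∀ z : ℂ, MvPolynomial.eval ![exp z, exp ((a : ℂ) * z + b)] P = 0 → |z.re| ≤ K := by
  obtain ⟨K, hK⟩ := abs_log_norm_le_of_eval_eq_zero ha hP |b.re|
  refine ⟨K, fun z hz => ?_⟩
  have h := hK ![exp z, exp ((a : ℂ) * z + b)] (by simp) (by simp) hz
  simp only [Matrix.cons_val_zero, Matrix.cons_val_one, Matrix.cons_val_fin_one,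
    Complex.norm_exp, Real.log_exp, rf_re_line] at h
  exact h (by ring_nf; exact le_rfl)

/-- **Infinitely many exponential points.** For `a ∈ ℝ ∖ ℚ` and any `P` whose zero set meets
`(ℂˣ)²`, `P(e^z, e^{az+b}) = 0` has infinitely many solutions (a sequence of them tends to
infinity, by accumulation at a unimodular zero). Existence of one is IN PRINT (Mantova–Masser 2024
Thm 1.2; Gallinaro 2023 Thm 8.8). (new) -/
theorem setOf_eval_exp_eq_zero_infinite (ha : Irrational a) (b : ℂ)
    (hW : ∃ c : Fin 2 → ℂ, c 0 ≠ 0 ∧ c 1 ≠ 0 ∧ MvPolynomial.eval c P = 0) :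
    {z : ℂ | MvPolynomial.eval ![exp z, exp ((a : ℂ) * z + b)] P = 0}.Infinite := by
  by_cases hP : P = 0
  · subst hP
    simp only [map_zero, Set.setOf_true]
    exact Set.infinite_univ
  obtain ⟨u, x, hu, hx⟩ := exists_unimodular_zero ha b hP hW
  obtain ⟨z, hz, hnorm, -⟩ := exists_seq_zero_tendsto ha b hP hu hx
  have hsub : Set.range z ⊆ {z : ℂ | MvPolynomial.eval ![exp z, exp ((a : ℂ) * z + b)] P = 0} := by
    rintro _ ⟨k, rfl⟩
    have h := hz k
    have e : rfPt a b 1 (z k) = ![exp (z k), exp ((a : ℂ) * z k + b)] := by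
      funext i; fin_cases i <;> simp [rfPt]
    rwa [curveFn, e] at h
  refine Set.Infinite.mono hsub ?_
  intro hfin
  obtain ⟨M, hM⟩ := (hfin.image fun w => ‖w‖).bddAbove
  have hle : ∀ k, ‖z k‖ ≤ M := fun k => hM ⟨z k, ⟨k, rfl⟩, rfl⟩
  obtain ⟨k, hk⟩ := (hnorm.eventually (eventually_gt_atTop M)).exists
  exact (lt_irrefl M) (lt_of_lt_of_le hk (hle k))

/-- **Unbounded imaginary parts.** Consequently (strip + infinitude) the exponential points have
solutions with `|Im z|` arbitrarily large. (new) -/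
theorem exists_eval_exp_eq_zero_im_gt (ha : Irrational a) (b : ℂ)
    (hW : ∃ c : Fin 2 → ℂ, c 0 ≠ 0 ∧ c 1 ≠ 0 ∧ MvPolynomial.eval c P = 0) (R : ℝ) :
    ∃ z : ℂ, MvPolynomial.eval ![exp z, exp ((a : ℂ) * z + b)] P = 0 ∧ R < |z.im| := by
  by_cases hP : P = 0
  · refine ⟨((|R| + 1 : ℝ) : ℂ) * I, by simp [hP], ?_⟩
    simp only [mul_im, ofReal_re, I_im, mul_one, ofReal_im, I_re, mul_zero, add_zero]
    rw [abs_of_pos (by positivity)]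
    linarith [le_abs_self R]
  obtain ⟨K, hK⟩ := exists_strip_of_eval_exp_eq_zero ha b hP
  obtain ⟨u, x, hu, hx⟩ := exists_unimodular_zero ha b hP hW
  obtain ⟨z, hz, hnorm, -⟩ := exists_seq_zero_tendsto ha b hP hu hx
  obtain ⟨k, hk⟩ := (hnorm.eventually (eventually_gt_atTop (K + |R|))).exists
  have hzk : MvPolynomial.eval ![exp (z k), exp ((a : ℂ) * z k + b)] P = 0 := by
    have h := hz k
    have e : rfPt a b 1 (z k) = ![exp (z k), exp ((a : ℂ) * z k + b)] := by
      funext i; fin_cases i <;> simp [rfPt]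
    rwa [curveFn, e] at h
  refine ⟨z k, hzk, ?_⟩
  have hre := hK (z k) hzk
  have htri : ‖z k‖ ≤ |(z k).re| + |(z k).im| := Complex.norm_le_abs_re_add_abs_im _
  linarith [le_abs_self R]

end Points

end Summit.Schanuel.Schanuel.Theorems
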